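import Mathlib
import Summits.Ventures.PercRepro2.V2SP
import Summits.Ventures.PercRepro2.Tail2DTailAvg
import Summits.Ventures.PercRepro2.Tail2DPathUpper
import Summits.Ventures.PercRepro2.Tail2DLeafPar

/-!
# Stochastic domination of the conditioned tails (SD)
(seat mine-b, cell pub-perc-repro2; conjectures/MINE-B.md §41)

For a tail `E(a,c) = {x : r(x) ≥ a ∧ b(x) ≥ c}` write `T(a,c) = #E(a,c)` (`tailCount`) and, for a weight
`f : s.Conf → ℕ`, `Σ_f(a,c) = Σ_{x ∈ E(a,c)} f x` (`tailSum`).  **(SD)(a,c)**: the uniform measure on `E(a,c)` is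
stochastically dominated, in the configuration order `red < blue`, by the uniform measure on the one-step-bluer
tail `E(a−1,c+1)` — for every MONOTONE weight `f`, `Σ_f(a,c) · T(a−1,c+1) ≤ Σ_f(a−1,c+1) · T(a,c)` (the average
of `f` over the tail does not decrease when the tail moves one step bluer; by Strassen's theorem, not needed
here, this is a coupling of the two conditioned configurations with the bluer one above).  Positions are taken
in `ℤ²` and clipped to `ℕ²` (`SDomZ`), so that the boundary members `E(a,0) ≼ E(a−1,0)` and `E(0,c) ≼ E(0,c+1)`
belong to the same family.  Census (own exact max-flow code): (SD) holds at EVERY position on all 809 pin-free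
SP networks ≤ 8 edges (0 / 3,065, `p = 1/2`; also `p = 1/3, 1/4, 3/4` ≤ 6–7 edges); it FAILS for skewed product
measures (the (PE) witness of §40.5 with pins) and at the CELL level; only the anti-diagonal shifts are valid.

Here: the definition; **(SD) ⟹ (T-AVG)** (`tailAvg_of_sdomZ`: the blue-path count is a monotone weight);
**the series step** (`sdomZ_ser`); **the atoms**; **the parallel step with one free edge** (`sdomZ_par_free`,
`sdomZ_free_par`): from (SD) of `s` at the fibre positions `(u−1,v)`, `(u,v−1)` and the anti-diagonal
log-concavity `T(u,v−1)·T(u−2,v+1) ≤ T(u−1,v)²` of its tails ((TAIL-LC), `IsMTail.antidiag`), by the three-part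
coupling red → red, excess of red → blue on the same tail set, blue → blue (`parFree_core`); hence (SD) at every
position on every leaf-parallel pattern with log-concave tails (`sdomZ_leafPar`).
-/

namespace Summit.Ventures.PercRepro2.Tail2D

open V2Closure

section Defs

variable (s : V2Closure.SP)

/-- the tail set `E(a,c) = {x : r ≥ a ∧ b ≥ c}` -/
def tailSet (a c : ℕ) : Finset s.Conf :=
  Finset.univ.filter (fun x : s.Conf => a ≤ s.rLab x ∧ c ≤ s.bLab x)

/-- the tail count is the cardinality of the tail set -/
theorem tailCount_eq_card (a c : ℕ) : tailCount s a c = (tailSet s a c).card := rfl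

/-- the `f`-mass of the tail set: `Σ_f(a,c) = Σ_{x ∈ E(a,c)} f x` -/
def tailSum (f : s.Conf → ℕ) (a c : ℕ) : ℕ := ∑ x ∈ tailSet s a c, f x

/-- **(SD) at the clipped position `(u,v) ∈ ℤ²`**: for every monotone weight `f`,
`Σ_f(u,v) · T(u−1,v+1) ≤ Σ_f(u−1,v+1) · T(u,v)` — the uniform measure on the tail `E(u,v)` is stochastically
dominated by the uniform measure on the one-step-bluer tail `E(u−1,v+1)` -/
def SDomZ (u v : ℤ) : Prop :=
  ∀ f : s.Conf → ℕ, Monotone f →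
    tailSum s f u.toNat v.toNat * tailCount s (u - 1).toNat (v + 1).toNat
      ≤ tailSum s f (u - 1).toNat (v + 1).toNat * tailCount s u.toNat v.toNat

/-- the anti-diagonal log-concavity of the clipped tails at the triple `(u,v−1), (u−1,v), (u−2,v+1)`
(the lane's (TAIL-LC)) -/
def TailLC (u v : ℤ) : Prop :=
  tailCount s u.toNat (v - 1).toNat * tailCount s (u - 2).toNat (v + 1).toNat
    ≤ tailCount s (u - 1).toNat v.toNat * tailCount s (u - 1).toNat v.toNat

/-- the blue-path mass of a tail is the tail sum of the blue-path count -/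
theorem tailPaths_eq_tailSum (a c : ℕ) :
    tailPaths s a c = tailSum s (fun x => Fintype.card (bluePaths s x)) a c := rfl

/-- **the blue-path count is a monotone weight** (a blue path of `x` is a path below `x`) -/
theorem monotone_card_bluePaths : Monotone (fun x : s.Conf => Fintype.card (bluePaths s x)) := by
  intro x y hxy
  simp only [card_bluePaths_eq_card_paths_le]
  apply Finset.card_le_card
  intro p hp
  simp only [Finset.mem_filter, Finset.mem_univ, true_and] at hp ⊢
  exact le_trans hp hxy

/-- **(SD) ⟹ (T-AVG)**: the tail-average monotonicity of the blue-path count at `(a,c)` is the instance of (SD)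
for the monotone weight `#bluePaths` -/
theorem tailAvg_of_sdomZ (a c : ℕ) (h : SDomZ s a c) : TailAvg s a c := by
  have key := h _ (monotone_card_bluePaths s)
  have e1 : ((a : ℤ)).toNat = a := by omega
  have e2 : ((a : ℤ) - 1).toNat = a - 1 := by omega
  have e3 : ((c : ℤ)).toNat = c := by omega
  have e4 : ((c : ℤ) + 1).toNat = c + 1 := by omega
  rw [e1, e2, e3, e4] at key
  exact key

end Defs

section Series

variable (s t : V2Closure.SP)

/-- the tail sum of a series composition is an iterated sum over the factors' tails (the tail set of a series
composition is the product of the tail sets) -/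
theorem tailSum_ser (f : (V2Closure.SP.ser s t).Conf → ℕ) (a c : ℕ) :
    tailSum (V2Closure.SP.ser s t) f a c = ∑ x ∈ tailSet s a c, ∑ y ∈ tailSet t a c, f (x, y) := by
  unfold tailSum tailSet
  simp only [Finset.sum_filter]
  refine Eq.trans (Fintype.sum_prod_type (fun p : s.Conf × t.Conf =>
    if a ≤ (V2Closure.SP.ser s t).rLab p ∧ c ≤ (V2Closure.SP.ser s t).bLab p then f p else 0)) ?_
  refine Finset.sum_congr rfl (fun x _ => ?_)
  by_cases hx : a ≤ s.rLab x ∧ c ≤ s.bLab x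
  · rw [if_pos hx]
    refine Finset.sum_congr rfl (fun y _ => ?_)
    simp only [SP.rLab, SP.bLab, serR, serB, le_min_iff]
    split_ifs <;> first | rfl | omega
  · rw [if_neg hx]
    refine Finset.sum_eq_zero (fun y _ => ?_)
    simp only [SP.rLab, SP.bLab, serR, serB, le_min_iff]
    split_ifs <;> first | rfl | omega

/-- **the series step of (SD)** -/
theorem sdomZ_ser (u v : ℤ) (hs : SDomZ s u v) (ht : SDomZ t u v) : SDomZ (V2Closure.SP.ser s t) u v := by
  intro f hf
  rw [tailSum_ser, tailSum_ser, tailCount_ser, tailCount_ser]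
  -- the fibre weights are monotone
  have hfy : ∀ x : s.Conf, Monotone (fun y : t.Conf => f (x, y)) := fun x y y' hyy' =>
    hf (Prod.mk_le_mk.2 ⟨le_rfl, hyy'⟩)
  have hfx : ∀ (a c : ℕ), Monotone (fun x : s.Conf => ∑ y ∈ tailSet t a c, f (x, y)) :=
    fun a c x x' hxx' => Finset.sum_le_sum (fun y _ => hf (Prod.mk_le_mk.2 ⟨hxx', le_rfl⟩))
  -- step 1: (SD) of `t` on every fibre
  have h1 : (∑ x ∈ tailSet s u.toNat v.toNat, ∑ y ∈ tailSet t u.toNat v.toNat, f (x, y))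
        * tailCount t (u - 1).toNat (v + 1).toNat
      ≤ (∑ x ∈ tailSet s u.toNat v.toNat, ∑ y ∈ tailSet t (u - 1).toNat (v + 1).toNat, f (x, y))
        * tailCount t u.toNat v.toNat := by
    rw [Finset.sum_mul, Finset.sum_mul]
    exact Finset.sum_le_sum (fun x _ => ht _ (hfy x))
  -- step 2: (SD) of `s` on the summed fibre weight
  have h2 : (∑ x ∈ tailSet s u.toNat v.toNat, ∑ y ∈ tailSet t (u - 1).toNat (v + 1).toNat, f (x, y))
        * tailCount s (u - 1).toNat (v + 1).toNat
      ≤ (∑ x ∈ tailSet s (u - 1).toNat (v + 1).toNat, ∑ y ∈ tailSet t (u - 1).toNat (v + 1).toNat, f (x, y))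
        * tailCount s u.toNat v.toNat :=
    hs _ (hfx _ _)
  calc (∑ x ∈ tailSet s u.toNat v.toNat, ∑ y ∈ tailSet t u.toNat v.toNat, f (x, y))
        * (tailCount s (u - 1).toNat (v + 1).toNat * tailCount t (u - 1).toNat (v + 1).toNat)
      = ((∑ x ∈ tailSet s u.toNat v.toNat, ∑ y ∈ tailSet t u.toNat v.toNat, f (x, y))
          * tailCount t (u - 1).toNat (v + 1).toNat) * tailCount s (u - 1).toNat (v + 1).toNat := by ring
    _ ≤ ((∑ x ∈ tailSet s u.toNat v.toNat, ∑ y ∈ tailSet t (u - 1).toNat (v + 1).toNat, f (x, y))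
          * tailCount t u.toNat v.toNat) * tailCount s (u - 1).toNat (v + 1).toNat :=
        Nat.mul_le_mul_right _ h1
    _ = ((∑ x ∈ tailSet s u.toNat v.toNat, ∑ y ∈ tailSet t (u - 1).toNat (v + 1).toNat, f (x, y))
          * tailCount s (u - 1).toNat (v + 1).toNat) * tailCount t u.toNat v.toNat := by ring
    _ ≤ ((∑ x ∈ tailSet s (u - 1).toNat (v + 1).toNat, ∑ y ∈ tailSet t (u - 1).toNat (v + 1).toNat, f (x, y))
          * tailCount s u.toNat v.toNat) * tailCount t u.toNat v.toNat :=
        Nat.mul_le_mul_right _ h2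
    _ = (∑ x ∈ tailSet s (u - 1).toNat (v + 1).toNat, ∑ y ∈ tailSet t (u - 1).toNat (v + 1).toNat, f (x, y))
          * (tailCount s u.toNat v.toNat * tailCount t u.toNat v.toNat) := by ring

end Series

section Atoms

/-- sums over the configurations of a free edge -/
theorem sum_free_conf (g : Bool → ℕ) :
    Finset.sum (Finset.univ : Finset V2Closure.SP.free.Conf) g = g true + g false :=
  Fintype.sum_bool g

/-- sums over the configurations of a pinned edge -/
theorem sum_pin_conf (g : Unit → ℕ) : Finset.sum (Finset.univ : Finset V2Closure.SP.pin.Conf) g = g () :=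
  Fintype.sum_unique g

/-- sums over the configurations of an absent edge -/
theorem sum_absent_conf (g : Unit → ℕ) : Finset.sum (Finset.univ : Finset V2Closure.SP.absent.Conf) g = g () :=
  Fintype.sum_unique g

/-- **(SD) on a free edge** at every position -/
theorem sdomZ_free (u v : ℤ) : SDomZ V2Closure.SP.free u v := by
  intro f hf
  have hRB : f false ≤ f true := hf (Bool.false_le true)
  unfold tailSum tailSet tailCount
  rw [Finset.sum_filter, Finset.sum_filter, Finset.card_filter, Finset.card_filter,
    sum_free_conf, sum_free_conf, sum_free_conf, sum_free_conf]
  simp only [SP.rLab, SP.bLab]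
  simp
  split_ifs <;> omega

/-- **(SD) on a pinned edge** at every position -/
theorem sdomZ_pin (u v : ℤ) : SDomZ V2Closure.SP.pin u v := by
  intro f _
  unfold tailSum tailSet tailCount
  rw [Finset.sum_filter, Finset.sum_filter, Finset.card_filter, Finset.card_filter,
    sum_pin_conf, sum_pin_conf, sum_pin_conf, sum_pin_conf]
  simp only [SP.rLab, SP.bLab]
  split_ifs <;> omega

/-- **(SD) on an absent edge** at every position -/
theorem sdomZ_absent (u v : ℤ) : SDomZ V2Closure.SP.absent u v := by
  intro f _
  unfold tailSum tailSet tailCount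
  rw [Finset.sum_filter, Finset.sum_filter, Finset.card_filter, Finset.card_filter,
    sum_absent_conf, sum_absent_conf, sum_absent_conf, sum_absent_conf]
  simp only [SP.rLab, SP.bLab]
  split_ifs <;> omega

end Atoms

section ParFree

variable (s : V2Closure.SP)

/-- the tail sum of `s ∥ e` splits by the colour of the free edge: the red fibre is the tail `(a−1, c)` of `s`,
the blue fibre the tail `(a, c−1)` -/
theorem tailSum_par_free (f : (V2Closure.SP.par s V2Closure.SP.free).Conf → ℕ) (a c : ℕ) :
    tailSum (V2Closure.SP.par s V2Closure.SP.free) f a c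
      = tailSum s (fun x => f ((x, false) : s.Conf × Bool)) (a - 1) c
        + tailSum s (fun x => f ((x, true) : s.Conf × Bool)) a (c - 1) := by
  unfold tailSum tailSet
  simp only [Finset.sum_filter]
  rw [← Finset.sum_add_distrib]
  refine Eq.trans (Fintype.sum_prod_type (fun p : s.Conf × Bool =>
    if a ≤ (V2Closure.SP.par s V2Closure.SP.free).rLab p ∧ c ≤ (V2Closure.SP.par s V2Closure.SP.free).bLab p
    then f p else 0)) ?_
  refine Finset.sum_congr rfl (fun x _ => ?_)
  rw [Fintype.sum_bool]
  simp only [SP.rLab, SP.bLab, parR, parB]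
  simp
  split_ifs <;> omega

/-- the tail count of `s ∥ e` splits by the colour of the free edge -/
theorem tailCount_par_free (a c : ℕ) :
    tailCount (V2Closure.SP.par s V2Closure.SP.free) a c = tailCount s (a - 1) c + tailCount s a (c - 1) := by
  unfold tailCount
  simp only [Finset.card_filter]
  rw [← Finset.sum_add_distrib]
  refine Eq.trans (Fintype.sum_prod_type (fun p : s.Conf × Bool =>
    if a ≤ (V2Closure.SP.par s V2Closure.SP.free).rLab p ∧ c ≤ (V2Closure.SP.par s V2Closure.SP.free).bLab p
    then 1 else 0)) ?_
  refine Finset.sum_congr rfl (fun x _ => ?_)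
  rw [Fintype.sum_bool]
  simp only [SP.rLab, SP.bLab, parR, parB]
  simp
  split_ifs <;> omega

/-- the algebraic core of the one-edge parallel step: from `A·t₂ ≤ C·t₁` (the red fibre), `B·t₁ ≤ D·t₀` (the blue
fibre), `A ≤ D` (the same tail set, a larger weight), the log-concavity `t₀·t₂ ≤ t₁²` and `t₀ = 0 → B = 0`
(an empty tail carries no mass), `(A + B)(t₂ + t₁) ≤ (C + D)(t₁ + t₀)` — the three-part coupling: the red part
of mass `t₂/(t₁+t₂)` goes to the red part, its excess to the blue part on the same tail set, the blue part to the
blue part -/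
theorem parFree_core (A B C D t0 t1 t2 : ℕ) (hR : A * t2 ≤ C * t1) (hB : B * t1 ≤ D * t0) (hAD : A ≤ D)
    (hLC : t0 * t2 ≤ t1 * t1) (hB0 : t0 = 0 → B = 0) : (A + B) * (t2 + t1) ≤ (C + D) * (t1 + t0) := by
  -- the mass split: `t₂·(t₀ + t₁) ≤ t₁·(t₁ + t₂)`
  have hM : t2 * (t0 + t1) ≤ t1 * (t1 + t2) := by nlinarith
  -- the excess of the red part goes to the blue part on the same tail set
  have hiv : A * (t1 * (t1 + t2)) + D * (t2 * (t0 + t1)) ≤ D * (t1 * (t1 + t2)) + A * (t2 * (t0 + t1)) := by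
    obtain ⟨d, hd⟩ := Nat.exists_eq_add_of_le hAD
    obtain ⟨e, he⟩ := Nat.exists_eq_add_of_le hM
    rw [hd, he]
    nlinarith [Nat.zero_le (d * e)]
  have key : (A + B) * (t2 + t1) * t1 ≤ (C + D) * (t1 + t0) * t1 := by
    nlinarith [Nat.mul_le_mul_right (t0 + t1) hR, Nat.mul_le_mul_right (t1 + t2) hB, hiv]
  rcases Nat.eq_zero_or_pos t1 with h0 | hpos
  · -- `t₁ = 0`: then `A = 0` by `hR`-type vanishing is not needed — `t₀·t₂ = 0` kills one side
    subst h0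
    have h00 : t0 * t2 = 0 := by omega
    rcases Nat.mul_eq_zero.1 h00 with h | h
    · subst h
      have hB' : B = 0 := hB0 rfl
      subst hB'
      have hA : A * t2 = 0 := by omega
      calc (A + 0) * (t2 + 0) = A * t2 := by ring
        _ = 0 := hA
        _ ≤ (C + D) * (0 + 0) := Nat.zero_le _
    · subst h
      simp
  · exact Nat.le_of_mul_le_mul_right key hpos

/-- **the parallel step of (SD) with one free edge**: from (SD) of `s` at the fibre positions `(u−1, v)` and
`(u, v−1)` and the anti-diagonal log-concavity of the tails of `s`, (SD) of `s ∥ e` at `(u, v)` -/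
theorem sdomZ_par_free (u v : ℤ) (hR : SDomZ s (u - 1) v) (hB : SDomZ s u (v - 1)) (hLC : TailLC s u v) :
    SDomZ (V2Closure.SP.par s V2Closure.SP.free) u v := by
  intro f hf
  rw [tailSum_par_free, tailSum_par_free, tailCount_par_free, tailCount_par_free]
  have hfR : Monotone (fun x : s.Conf => f ((x, false) : s.Conf × Bool)) := fun x y h =>
    hf (Prod.mk_le_mk.2 ⟨h, le_rfl⟩)
  have hfB : Monotone (fun x : s.Conf => f ((x, true) : s.Conf × Bool)) := fun x y h =>
    hf (Prod.mk_le_mk.2 ⟨h, le_rfl⟩)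
  have hRB : ∀ x : s.Conf, f ((x, false) : s.Conf × Bool) ≤ f ((x, true) : s.Conf × Bool) := fun x =>
    hf (Prod.mk_le_mk.2 ⟨le_rfl, Bool.false_le true⟩)
  -- the clipped positions
  have e1 : u.toNat - 1 = (u - 1).toNat := by omega
  have e2 : v.toNat - 1 = (v - 1).toNat := by omega
  have e3 : (u - 1).toNat - 1 = (u - 1 - 1).toNat := by omega
  have e4 : (v + 1).toNat - 1 = (v - 1 + 1).toNat := by omega
  have e5 : (u - 1 - 1).toNat = (u - 2).toNat := by omega
  have e6 : (v - 1 + 1).toNat = v.toNat := by omega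
  rw [e1, e2, e3, e4]
  have hR' := hR _ hfR
  have hB' := hB _ hfB
  rw [e5] at hR' ⊢
  rw [e6] at hB' ⊢
  have hAD : tailSum s (fun x => f ((x, false) : s.Conf × Bool)) (u - 1).toNat v.toNat
      ≤ tailSum s (fun x => f ((x, true) : s.Conf × Bool)) (u - 1).toNat v.toNat :=
    Finset.sum_le_sum (fun x _ => hRB x)
  unfold TailLC at hLC
  have hB0 : tailCount s u.toNat (v - 1).toNat = 0 →
      tailSum s (fun x => f ((x, true) : s.Conf × Bool)) u.toNat (v - 1).toNat = 0 := by
    intro h0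
    unfold tailSum
    rw [tailCount_eq_card, Finset.card_eq_zero] at h0
    rw [h0, Finset.sum_empty]
  exact parFree_core _ _ _ _ _ _ _ hR' hB' hAD hLC hB0

end ParFree

section FreePar

variable (s : V2Closure.SP)

/-- the tail sum of `e ∥ s` splits by the colour of the free edge -/
theorem tailSum_free_par (f : (V2Closure.SP.par V2Closure.SP.free s).Conf → ℕ) (a c : ℕ) :
    tailSum (V2Closure.SP.par V2Closure.SP.free s) f a c
      = tailSum s (fun x => f ((false, x) : Bool × s.Conf)) (a - 1) c
        + tailSum s (fun x => f ((true, x) : Bool × s.Conf)) a (c - 1) := by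
  unfold tailSum tailSet
  simp only [Finset.sum_filter]
  rw [← Finset.sum_add_distrib]
  refine Eq.trans (Fintype.sum_prod_type (fun p : Bool × s.Conf =>
    if a ≤ (V2Closure.SP.par V2Closure.SP.free s).rLab p ∧ c ≤ (V2Closure.SP.par V2Closure.SP.free s).bLab p
    then f p else 0)) ?_
  rw [Fintype.sum_bool, Finset.sum_add_distrib, add_comm]
  refine congrArg₂ (· + ·) ?_ ?_ <;>
  refine Finset.sum_congr rfl (fun x _ => ?_) <;>
  simp only [SP.rLab, SP.bLab, parR, parB] <;>
  simp <;>
  split_ifs <;> omega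

/-- the tail count of `e ∥ s` splits by the colour of the free edge -/
theorem tailCount_free_par (a c : ℕ) :
    tailCount (V2Closure.SP.par V2Closure.SP.free s) a c = tailCount s (a - 1) c + tailCount s a (c - 1) := by
  unfold tailCount
  simp only [Finset.card_filter]
  refine Eq.trans (Fintype.sum_prod_type (fun p : Bool × s.Conf =>
    if a ≤ (V2Closure.SP.par V2Closure.SP.free s).rLab p ∧ c ≤ (V2Closure.SP.par V2Closure.SP.free s).bLab p
    then 1 else 0)) ?_
  rw [Fintype.sum_bool, add_comm]
  refine congrArg₂ (· + ·) ?_ ?_ <;>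
  refine Finset.sum_congr rfl (fun x _ => ?_) <;>
  simp only [SP.rLab, SP.bLab, parR, parB] <;>
  simp <;>
  split_ifs <;> omega

/-- **the parallel step of (SD) with one free edge on the left** -/
theorem sdomZ_free_par (u v : ℤ) (hR : SDomZ s (u - 1) v) (hB : SDomZ s u (v - 1)) (hLC : TailLC s u v) :
    SDomZ (V2Closure.SP.par V2Closure.SP.free s) u v := by
  intro f hf
  rw [tailSum_free_par, tailSum_free_par, tailCount_free_par, tailCount_free_par]
  have hfR : Monotone (fun x : s.Conf => f ((false, x) : Bool × s.Conf)) := fun x y h =>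
    hf (Prod.mk_le_mk.2 ⟨le_rfl, h⟩)
  have hfB : Monotone (fun x : s.Conf => f ((true, x) : Bool × s.Conf)) := fun x y h =>
    hf (Prod.mk_le_mk.2 ⟨le_rfl, h⟩)
  have hRB : ∀ x : s.Conf, f ((false, x) : Bool × s.Conf) ≤ f ((true, x) : Bool × s.Conf) := fun x =>
    hf (Prod.mk_le_mk.2 ⟨Bool.false_le true, le_rfl⟩)
  have e1 : u.toNat - 1 = (u - 1).toNat := by omega
  have e2 : v.toNat - 1 = (v - 1).toNat := by omega
  have e3 : (u - 1).toNat - 1 = (u - 1 - 1).toNat := by omega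
  have e4 : (v + 1).toNat - 1 = (v - 1 + 1).toNat := by omega
  have e5 : (u - 1 - 1).toNat = (u - 2).toNat := by omega
  have e6 : (v - 1 + 1).toNat = v.toNat := by omega
  rw [e1, e2, e3, e4]
  have hR' := hR _ hfR
  have hB' := hB _ hfB
  rw [e5] at hR' ⊢
  rw [e6] at hB' ⊢
  have hAD : tailSum s (fun x => f ((false, x) : Bool × s.Conf)) (u - 1).toNat v.toNat
      ≤ tailSum s (fun x => f ((true, x) : Bool × s.Conf)) (u - 1).toNat v.toNat :=
    Finset.sum_le_sum (fun x _ => hRB x)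
  unfold TailLC at hLC
  have hB0 : tailCount s u.toNat (v - 1).toNat = 0 →
      tailSum s (fun x => f ((true, x) : Bool × s.Conf)) u.toNat (v - 1).toNat = 0 := by
    intro h0
    unfold tailSum
    rw [tailCount_eq_card, Finset.card_eq_zero] at h0
    rw [h0, Finset.sum_empty]
  exact parFree_core _ _ _ _ _ _ _ hR' hB' hAD hLC hB0

end FreePar

section LeafPar

/-- **(SD) at every position on every leaf-parallel pattern (`Tail2DLeafPar.LeafPar`: atoms, series, parallel
with one free edge) whose intermediate patterns have anti-diagonally log-concave tails** (the lane's (TAIL-LC):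
a theorem on bundle-series tails, `IsMTail.antidiag`, and census-true on every SP pattern ≤ 16 atoms).  The
conclusion (SD) is stronger than the tail-average monotonicity already known unconditionally on this class
(`tailAvg_of_leafPar`): it is the Hall / normalized-matching form, `Σ_f(u,v)/T(u,v) ≤ Σ_f(u−1,v+1)/T(u−1,v+1)`
for EVERY monotone weight `f`. -/
theorem sdomZ_leafPar (hLC : ∀ s : V2Closure.SP, LeafPar s → ∀ u v : ℤ, TailLC s u v) :
    ∀ {s : V2Closure.SP}, LeafPar s → ∀ u v : ℤ, SDomZ s u v
  | _, .free, u, v => sdomZ_free u v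
  | _, .absent, u, v => sdomZ_absent u v
  | _, .ser hs ht, u, v => sdomZ_ser _ _ u v (sdomZ_leafPar hLC hs u v) (sdomZ_leafPar hLC ht u v)
  | _, .parFree hs, u, v =>
      sdomZ_par_free _ u v (sdomZ_leafPar hLC hs (u - 1) v) (sdomZ_leafPar hLC hs u (v - 1))
        (hLC _ hs u v)
  | _, .freePar hs, u, v =>
      sdomZ_free_par _ u v (sdomZ_leafPar hLC hs (u - 1) v) (sdomZ_leafPar hLC hs u (v - 1))
        (hLC _ hs u v)

end LeafPar

end Summit.Ventures.PercRepro2.Tail2D
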